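import Literature.AlgebraicGeometry.HodgeTheory.WeilFamilyReachOfPeriodConstruction
import Literature.AlgebraicGeometry.HodgeTheory.AbelianVarietyEndomorphismsHOne
import Literature.AlgebraicGeometry.Motives.AbelianVarietyCohomologyExteriorH1
import Mathlib.LinearAlgebra.Matrix.Charpoly.Minpoly
import Mathlib.LinearAlgebra.Eigenspace.Minpoly
import Mathlib.FieldTheory.IsAlgClosed.Basic
import Mathlib.FieldTheory.Separable
import Mathlib.RingTheory.PowerBasis
import Mathlib.Algebra.Squarefree.Basic
import HarnessLib

/-!
# Crux `HodgeAbelianVarieties` (stmt-HodgeConjecture-1333), line `cm-pivot` — the CM-typing BRIDGE, core: an endomorphism with `2 dim A` distinct eigenvalues on `H¹` generates an étale subalgebra of `End⁰(A)` of rank `2 dim A`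

Route `PadicSemiregularLift`, crux r4. The line `cm-pivot` (crux strategist, 2026-08-17) decomposes the crux as
`HodgeAbelianVarieties ⇐ HodgeCM ∧ CMAnchoredFamilies ∧ LocalVHCAtCM`, where `HodgeCM` = HC for complex abelian
varieties `A` of CM type in the typing `IsCM[A]` := "some endomorphism `ψ` of `A` has `2 · dim A` distinct
eigenvalues on `H¹(A(ℂ); ℂ)`". The tree ALREADY carries HC for CM abelian varieties as the shared item
`CMAbelianHodge` (stmt-HodgeConjecture-3052, routes `SupersingularIsotypicLift` / `RankFourFaces`) in the typing
"`End⁰(A) = ℚ ⊗ End A` contains a commutative reduced `ℚ`-subalgebra of dimension `2 · dim A`". This file proves,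
on the tree's real carriers, the classical fact that makes the first typing a special case of the second
(Mumford, *Abelian Varieties* §19, Cor. of Thm. 3 and §22; Shimura–Taniyama §5: for `ψ` with `2g` distinct
eigenvalues on `H¹ ⊗ ℂ`, `ℚ[ψ] ⊆ End⁰(A)` is a product of number fields of total degree `2g`):

* `exists_cmSubalgebra_of_eigenvalues` — **if `ψ : A → A` has `2 · dim A` distinct eigenvalues on
  `H¹(A(ℂ); ℂ)`, then `End⁰(A)` contains a commutative reduced `ℚ`-subalgebra `S` with
  `finrank ℚ S = 2 · dim A`** (namely `S = ℚ[1 ⊗ ψ]`).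

Proof on the carriers (everything is PROVED; no definition, no named fact): (1) `H¹(A(ℂ); ℂ)` has a
`ℂ`-basis of RATIONAL classes (`span_isRationalClass_eq_top_of_isSmoothProjective_holds`), of cardinality
`2 dim A` (`AbelianVariety.finrank_complexBetti_one`), in which every pull-back `f^*` has a rational matrix
(`repr_mem_range_ratCast_of_isRationalClass`): this gives a ring homomorphism `ρ : End A → M_{2g}(ℚ)`,
`f ↦ (matrix of f^*)ᵀ` (additive by `complexBetti_map_add_one`), INJECTIVE by faithfulness of the rational
representation (`AbelianVariety.hom_eq_of_complexBetti_map_one_eq`). (2) `ρ` extends to an injective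
`ℚ`-algebra homomorphism on `End⁰(A) = ℚ ⊗_ℤ End A` (every element is `n⁻¹ (1 ⊗ f)`). (3) So `a = 1 ⊗ ψ` is
integral with `minpoly ℚ a = minpoly ℚ (ρ ψ)`; the `2g` distinct eigenvalues of `ψ^*` are complex roots of it
(`Module.End.aeval_apply_of_hasEigenvector`) and it divides a `2g × 2g` characteristic polynomial: degree
exactly `2g`, `2g` distinct roots, separable, square-free. (4) Pure algebra: for an integral `a` in a (not
necessarily commutative) `ℚ`-algebra, `ℚ[a]` is commutative, of `finrank = natDegree (minpoly ℚ a)` (power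
basis; Mathlib's `linearIndependent_pow` / `IsIntegral.mem_span_pow`), and reduced when `minpoly` is square-free.

Consumers: `…CMPivotBridgeItems` (this seat): `CMAbelianHodge (stmt-3052) → HodgeCM[]` (child 1 of the CM pivot
becomes the EXISTING shared item) and `CMAnchoredFamilies[] → LocalVHCAtCM[] → RankFourFaces.CMToAbelian` (stmt-16267).
References: [MumfordAV1970] §19 Thm. 3 and corollaries (`End⁰(X)` acts faithfully on `H¹(X, ℚ)`,
`[ℚ[ψ] : ℚ] ≤ 2g`), §22 (CM type); Shimura–Taniyama (1961) §5.1 Prop. 1–3; [LangeBirkenhake1992] §1.1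
Prop. 1.1.6 (injectivity of the rational representation).
-/

set_option linter.dupNamespace false

noncomputable section

open CategoryTheory Polynomial
open scoped Matrix TensorProduct
open Literature.AlgebraicGeometry Literature.AlgebraicGeometry.Motives
  Literature.AlgebraicGeometry.HodgeTheory Literature.AlgebraicTopology.SingularHomology

namespace Summit.HodgeConjecture.HodgeConjecture.Theorems.HodgeAbelianVarieties.CMPivot

/-! ### Pure algebra: the subalgebra generated by one integral element -/

section Algebra

variable {C : Type*} [Ring C] [Algebra ℚ C]

/-- **`finrank ℚ ℚ[a] = deg (minpoly ℚ a)`** for an integral element `a` of a (possibly non-commutative)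
`ℚ`-algebra: the powers `1, a, …, a^{d-1}` form a basis (Mathlib's `linearIndependent_pow` and
`IsIntegral.mem_span_pow`, as in `Algebra.adjoin.powerBasisAux`, which is stated for commutative ambient
rings only). [folklore] -/
theorem finrank_adjoin_singleton_eq_natDegree {a : C} (ha : IsIntegral ℚ a) :
    Module.finrank ℚ (Algebra.adjoin ℚ ({a} : Set C)) = (minpoly ℚ a).natDegree := by
  set S : Subalgebra ℚ C := Algebra.adjoin ℚ ({a} : Set C) with hS
  have hinj : Function.Injective S.val := Subtype.coe_injective
  let x : S := ⟨a, Algebra.subset_adjoin (Set.mem_singleton a)⟩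
  have hxa : S.val x = a := rfl
  have hmin : minpoly ℚ x = minpoly ℚ a := by
    rw [← hxa]
    exact (minpoly.algHom_eq S.val hinj x).symm
  have hx : IsIntegral ℚ x := by rw [← isIntegral_algHom_iff S.val hinj, hxa]; exact ha
  have hli : LinearIndependent ℚ fun i : Fin (minpoly ℚ a).natDegree => x ^ (i : ℕ) := by
    rw [← hmin]
    exact linearIndependent_pow x
  have hsp : ⊤ ≤ Submodule.span ℚ (Set.range fun i : Fin (minpoly ℚ a).natDegree => x ^ (i : ℕ)) := by
    rintro y -
    rw [← hmin]
    refine hx.mem_span_pow ?_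
    obtain ⟨y, hy⟩ := y
    have hy' : y ∈ (aeval (R := ℚ) a).range := by
      rw [← Algebra.adjoin_singleton_eq_range_aeval]
      exact hy
    obtain ⟨f, rfl⟩ := (AlgHom.mem_range _).mp hy'
    refine ⟨f, Subtype.ext ?_⟩
    change aeval a f = S.val (aeval x f)
    rw [← Polynomial.aeval_algHom_apply, hxa]
  let b := Module.Basis.mk hli hsp
  rw [Module.finrank_eq_card_basis b, Fintype.card_fin]

/-- **`ℚ[a]` is reduced when `minpoly ℚ a` is square-free**: a nilpotent `p(a)` has `minpoly ∣ pⁿ`,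
hence `minpoly ∣ p` (a square-free element of the UFD `ℚ[X]` is radical), hence `p(a) = 0`. [folklore] -/
theorem isReduced_adjoin_singleton {a : C} (hsq : Squarefree (minpoly ℚ a)) :
    IsReduced (Algebra.adjoin ℚ ({a} : Set C)) := by
  refine ⟨fun y hy => ?_⟩
  obtain ⟨n, hn⟩ := hy
  obtain ⟨y, hymem⟩ := y
  have hy' : y ∈ (aeval (R := ℚ) a).range := by
    rw [← Algebra.adjoin_singleton_eq_range_aeval]
    exact hymem
  obtain ⟨p, rfl⟩ := (AlgHom.mem_range _).mp hy'
  have h0 : aeval a (p ^ n) = 0 := by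
    rw [map_pow]
    have := congrArg Subtype.val hn
    simpa using this
  have hdvd : minpoly ℚ a ∣ p := hsq.isRadical n p (minpoly.dvd ℚ a h0)
  have hp0 : aeval a p = 0 := by
    obtain ⟨q, hq⟩ := hdvd
    rw [hq, map_mul, minpoly.aeval, zero_mul]
  exact Subtype.ext hp0

/-- `ℚ[a]` is commutative: its elements are the `p(a)`. [folklore] -/
theorem mul_comm_of_mem_adjoin_singleton {a x y : C} (hx : x ∈ Algebra.adjoin ℚ ({a} : Set C))
    (hy : y ∈ Algebra.adjoin ℚ ({a} : Set C)) : x * y = y * x := by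
  rw [Algebra.adjoin_singleton_eq_range_aeval] at hx hy
  obtain ⟨p, rfl⟩ := (AlgHom.mem_range _).mp hx
  obtain ⟨q, rfl⟩ := (AlgHom.mem_range _).mp hy
  rw [← map_mul, ← map_mul, mul_comm]

/-- `p(Mᵀ) = p(M)ᵀ` for a square matrix over a commutative ring. [folklore] -/
theorem aeval_transpose {ι R : Type*} [Fintype ι] [DecidableEq ι] [CommRing R] (M : Matrix ι ι R)
    (p : R[X]) : aeval Mᵀ p = (aeval M p)ᵀ := by
  refine p.induction_on' (fun p q hp hq => ?_) (fun n r => ?_)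
  · rw [map_add, map_add, hp, hq, Matrix.transpose_add]
  · rw [aeval_monomial, aeval_monomial, Algebra.algebraMap_eq_smul_one, smul_mul_assoc, smul_mul_assoc,
      one_mul, one_mul, Matrix.transpose_smul, Matrix.transpose_pow]

end Algebra

/-! ### `End⁰(A) = ℚ ⊗_ℤ End A`: extending an injective ring homomorphism on `End A` -/

section EndAlgebra

variable (A : AbelianVariety ℂ)

/-- `k ⊗ f = 1 ⊗ k·f` in `ℚ ⊗_ℤ End A` for an integer `k`. [folklore] -/
theorem intCast_tmul (k : ℤ) (f : End A) : ((k : ℚ)) ⊗ₜ[ℤ] f = (1 : ℚ) ⊗ₜ[ℤ] (k • f) := by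
  rw [← zsmul_one k, TensorProduct.smul_tmul]

/-- In `ℚ ⊗_ℤ End A` every element is `n⁻¹ · (1 ⊗ f)` for some `n ≥ 1` and `f ∈ End A`
(clear denominators of the rational coefficients). [folklore] -/
theorem exists_nsmul_eq_tmul (x : ℚ ⊗[ℤ] End A) :
    ∃ n : ℕ, 0 < n ∧ ∃ f : End A, (n : ℚ) • x = (1 : ℚ) ⊗ₜ[ℤ] f := by
  -- scaling a witness
  have scale : ∀ (k c : ℕ) (y : ℚ ⊗[ℤ] End A) (f : End A), (k : ℚ) • y = (1 : ℚ) ⊗ₜ[ℤ] f →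
      ((c * k : ℕ) : ℚ) • y = (1 : ℚ) ⊗ₜ[ℤ] ((c : ℤ) • f) := fun k c y f h => by
    rw [Nat.cast_mul, mul_smul, h, TensorProduct.smul_tmul', smul_eq_mul, mul_one, ← Int.cast_natCast c,
      intCast_tmul]
  induction x using TensorProduct.induction_on with
  | zero => exact ⟨1, one_pos, 0, by rw [smul_zero, TensorProduct.tmul_zero]⟩
  | tmul q f =>
    refine ⟨q.den, q.den_pos, q.num • f, ?_⟩
    rw [TensorProduct.smul_tmul', smul_eq_mul, Rat.den_mul_eq_num, intCast_tmul]
  | add x y hx hy =>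
    obtain ⟨m, hm, f, hf⟩ := hx
    obtain ⟨n, hn, g, hg⟩ := hy
    refine ⟨m * n, Nat.mul_pos hm hn, (n : ℤ) • f + (m : ℤ) • g, ?_⟩
    have ef : ((n * m : ℕ) : ℚ) • x = (1 : ℚ) ⊗ₜ[ℤ] ((n : ℤ) • f) := scale m n x f hf
    have eg : ((m * n : ℕ) : ℚ) • y = (1 : ℚ) ⊗ₜ[ℤ] ((m : ℤ) • g) := scale n m y g hg
    rw [Nat.mul_comm n m] at ef
    rw [smul_add, ef, eg, ← TensorProduct.tmul_add]

/-- **An injective ring homomorphism `End A → C` into a `ℚ`-algebra extends to an injective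
`ℚ`-algebra homomorphism `End⁰(A) = ℚ ⊗_ℤ End A → C`** (`q ⊗ f ↦ q · ρ f`; injective because
every element of `End⁰(A)` is `n⁻¹ (1 ⊗ f)`). [cite: MumfordAV1970, §19 (the structure of End⁰(X))] -/
theorem exists_algHom_endAlgebra_extend {C : Type*} [Ring C] [Algebra ℚ C] (ρ : End A →+* C)
    (hρ : Function.Injective ρ) :
    ∃ σ : A.endAlgebra →ₐ[ℚ] C, Function.Injective σ ∧
      ∀ f : End A, σ (AbelianVariety.endAlgebra.of A f) = ρ f := by
  let ρ' : End A →ₐ[ℤ] C :=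
    { ρ with
      commutes' := fun n ↦ RingHom.congr_fun
        (RingHom.ext_int (ρ.comp (algebraMap ℤ (End A))) (algebraMap ℤ C)) n }
  have hρ' : ∀ f, ρ' f = ρ f := fun _ => rfl
  let σ : A.endAlgebra →ₐ[ℚ] C :=
    Algebra.TensorProduct.lift (Algebra.ofId ℚ C) ρ' fun q _ ↦ Algebra.commute_algebraMap_left q _
  have hσ : ∀ f : End A, σ (AbelianVariety.endAlgebra.of A f) = ρ f := fun f => by
    change Algebra.TensorProduct.lift (Algebra.ofId ℚ C) ρ' _ ((1 : ℚ) ⊗ₜ[ℤ] f) = ρ f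
    rw [Algebra.TensorProduct.lift_tmul, map_one, one_mul, hρ']
  refine ⟨σ, (injective_iff_map_eq_zero σ).2 fun x hx => ?_, hσ⟩
  obtain ⟨n, hn, f, hf⟩ := exists_nsmul_eq_tmul A x
  have hf' : (n : ℚ) • x = AbelianVariety.endAlgebra.of A f := hf -- `endAlgebra.of A f = 1 ⊗ f`
  have h1 : σ ((n : ℚ) • x) = 0 := by rw [map_smul, hx, smul_zero]
  rw [hf', hσ] at h1
  have hf0 : f = 0 := hρ (by rw [h1, map_zero])
  rw [hf0, map_zero] at hf'
  have hn0 : (n : ℚ) ≠ 0 := by exact_mod_cast hn.ne'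
  calc x = (n : ℚ)⁻¹ • ((n : ℚ) • x) := by rw [smul_smul, inv_mul_cancel₀ hn0, one_smul]
    _ = 0 := by rw [hf', smul_zero]

end EndAlgebra

/-! ### The theorem -/

section Main

variable (A : AbelianVariety ℂ)

/-- **An endomorphism with `2 · dim A` distinct eigenvalues on `H¹(A(ℂ); ℂ)` generates a commutative
reduced subalgebra of `End⁰(A)` of `ℚ`-dimension `2 · dim A`** (so "CM type" in the eigenvalue typing
`IsCM[A]` of the `HodgeAbelianVarieties` crux lines implies "CM type" in the typing of the shared item
`CMAbelianHodge`, stmt-HodgeConjecture-3052): `S = ℚ[1 ⊗ ψ] ⊆ ℚ ⊗_ℤ End A`. Proof: the rational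
representation `f ↦ (matrix of f^* in a rational basis of H¹)ᵀ` is an injective ring homomorphism
`End A → M_{2g}(ℚ)` (faithfulness `AbelianVariety.hom_eq_of_complexBetti_map_one_eq`, additivity
`complexBetti_map_add_one`), extends injectively to `End⁰(A)`, so `minpoly ℚ (1 ⊗ ψ)` is the minimal
polynomial of a `2g × 2g` rational matrix whose complexification has the `2g` distinct eigenvalues `μ i`:
degree exactly `2g`, separable, whence `ℚ[1 ⊗ ψ] ≅ ℚ[X]/(minpoly)` is reduced of dimension `2g`.
[cite: MumfordAV1970, §19 Thm. 3 Cor. and §22] -/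
theorem exists_cmSubalgebra_of_eigenvalues (ψ : A ⟶ A) (μ : Fin (2 * A.dim) → ℂ)
    (hμ : Function.Injective μ)
    (hμe : ∀ i, Module.End.HasEigenvalue (complexBetti.map ψ.hom.hom.hom 1).hom (μ i)) :
    ∃ S : Subalgebra ℚ A.endAlgebra, IsReduced S ∧ (∀ x ∈ S, ∀ y ∈ S, x * y = y * x) ∧
      Module.finrank ℚ S = 2 * A.dim := by
  classical
  -- (1) a rational basis of `H¹(A(ℂ); ℂ)`
  haveI := finite_complexBetti_abelianVariety A 1
  obtain ⟨t, hts, htspan, hli⟩ :=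
    exists_linearIndependent ℂ {c : complexBetti A.X 1 | IsRationalClass c}
  have hspan : Submodule.span ℂ {c : complexBetti A.X 1 | IsRationalClass c} = ⊤ :=
    span_isRationalClass_eq_top_of_isSmoothProjective_holds _ _
      (AbelianVariety.isSmoothProjective_holds (A := A)) 1
  haveI : Fintype t := (hli.set_finite_of_isNoetherian).fintype
  let b : Module.Basis t ℂ (complexBetti A.X 1) :=
    Module.Basis.mk hli (by rw [Subtype.range_coe, htspan, hspan])
  have hb : ∀ i, IsRationalClass (b i) := fun i => by
    rw [Module.Basis.mk_apply]
    exact hts i.2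
  have hcard : Fintype.card t = 2 * A.dim := by
    rw [← Module.finrank_eq_card_basis b]
    exact AbelianVariety.finrank_complexBetti_one A
  -- (2) the matrix of `f^*` in `b` is rational
  let Φ : Matrix t t ℚ →+* Matrix t t ℂ := (algebraMap ℚ ℂ).mapMatrix
  have hΦinj : Function.Injective Φ := fun X Y h =>
    Matrix.map_injective (algebraMap ℚ ℂ).injective (by simpa [Φ, RingHom.mapMatrix_apply] using h)
  have hrat : ∀ (f : A ⟶ A) (i j : t), ∃ q : ℚ, algebraMap ℚ ℂ q =
      LinearMap.toMatrixAlgEquiv b (complexBetti.map f.hom.hom.hom 1).hom i j := fun f i j => by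
    obtain ⟨q, hq⟩ := repr_mem_range_ratCast_of_isRationalClass b hb ((hb j).pullback _) i
    exact ⟨q, by rw [LinearMap.toMatrixAlgEquiv_apply, eq_ratCast]; exact hq⟩
  choose M hM using hrat
  have hMmap : ∀ f : A ⟶ A, Φ (Matrix.of (M f)) =
      LinearMap.toMatrixAlgEquiv b (complexBetti.map f.hom.hom.hom 1).hom := fun f => by
    ext i j
    rw [RingHom.mapMatrix_apply, Matrix.map_apply, Matrix.of_apply]
    exact hM f i j
  -- (3) functoriality of `f ↦ matrix of f^*`
  have hT_id : LinearMap.toMatrixAlgEquiv b (complexBetti.map (𝟙 A : A ⟶ A).hom.hom.hom 1).hom = 1 := by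
    change LinearMap.toMatrixAlgEquiv b (complexBetti.map (𝟙 A.X) 1).hom = 1
    rw [complexBetti.map_id, ModuleCat.hom_id]
    exact map_one _
  have hT_comp : ∀ f g : A ⟶ A,
      LinearMap.toMatrixAlgEquiv b (complexBetti.map (f ≫ g).hom.hom.hom 1).hom =
        LinearMap.toMatrixAlgEquiv b (complexBetti.map f.hom.hom.hom 1).hom *
          LinearMap.toMatrixAlgEquiv b (complexBetti.map g.hom.hom.hom 1).hom := fun f g => by
    rw [← map_mul]
    change LinearMap.toMatrixAlgEquiv b (complexBetti.map (f.hom.hom.hom ≫ g.hom.hom.hom) 1).hom = _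
    rw [complexBetti.map_comp, ModuleCat.hom_comp]
    rfl
  have hT_add : ∀ f g : A ⟶ A,
      LinearMap.toMatrixAlgEquiv b (complexBetti.map (f + g).hom.hom.hom 1).hom =
        LinearMap.toMatrixAlgEquiv b (complexBetti.map f.hom.hom.hom 1).hom +
          LinearMap.toMatrixAlgEquiv b (complexBetti.map g.hom.hom.hom 1).hom := fun f g => by
    rw [complexBetti_map_add_one, ModuleCat.hom_add, map_add]
  have hM_one : Matrix.of (M (𝟙 A)) = 1 := hΦinj (by rw [hMmap, hT_id, map_one])
  have hM_comp : ∀ f g : A ⟶ A, Matrix.of (M (f ≫ g)) = Matrix.of (M f) * Matrix.of (M g) :=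
    fun f g => hΦinj (by rw [map_mul, hMmap, hMmap, hMmap, hT_comp])
  have hM_add : ∀ f g : A ⟶ A, Matrix.of (M (f + g)) = Matrix.of (M f) + Matrix.of (M g) :=
    fun f g => hΦinj (by rw [map_add, hMmap, hMmap, hMmap, hT_add])
  -- (4) the injective ring homomorphism `ρ : End A → Matrix t t ℚ`, `f ↦ (M f)ᵀ`
  let ρ₀ : End A →* Matrix t t ℚ :=
    { toFun := fun f => (Matrix.of (M f))ᵀ
      map_one' := by
        change (Matrix.of (M (𝟙 A)))ᵀ = 1
        rw [hM_one, Matrix.transpose_one]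
      map_mul' := fun f g => by
        change (Matrix.of (M (g ≫ f)))ᵀ = (Matrix.of (M f))ᵀ * (Matrix.of (M g))ᵀ
        rw [hM_comp, Matrix.transpose_mul] }
  let ρ : End A →+* Matrix t t ℚ := RingHom.mk' ρ₀ fun f g => by
    change (Matrix.of (M (f + g)))ᵀ = (Matrix.of (M f))ᵀ + (Matrix.of (M g))ᵀ
    rw [← Matrix.transpose_add]
    exact congrArg Matrix.transpose (hM_add f g)
  have hρ_apply : ∀ f : A ⟶ A, ρ f = (Matrix.of (M f))ᵀ := fun f => rfl
  have hρinj : Function.Injective ρ := by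
    intro f g hfg
    rw [hρ_apply, hρ_apply] at hfg
    have h1 : Matrix.of (M f) = Matrix.of (M g) := Matrix.transpose_injective hfg
    have h2 := congrArg Φ h1
    rw [hMmap, hMmap] at h2
    exact AbelianVariety.hom_eq_of_complexBetti_map_one_eq
      (ModuleCat.hom_ext ((LinearMap.toMatrixAlgEquiv b).injective h2))
  -- (5) extension to `End⁰(A)` and the element `a = 1 ⊗ ψ`
  obtain ⟨σ, hσinj, hσof⟩ := exists_algHom_endAlgebra_extend A ρ hρinj
  set a : A.endAlgebra := AbelianVariety.endAlgebra.of A ψ with ha_def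
  set N : Matrix t t ℚ := ρ ψ with hN_def
  have hσa : σ a = N := hσof ψ
  have hNint : IsIntegral ℚ N := Matrix.isIntegral N
  have haint : IsIntegral ℚ a := by
    rw [← isIntegral_algHom_iff σ hσinj, hσa]
    exact hNint
  have hmin : minpoly ℚ a = minpoly ℚ N := by
    rw [← hσa]
    exact (minpoly.algHom_eq σ hσinj a).symm
  -- (6) the minimal polynomial of `N` kills `ψ^*`
  set P : ℚ[X] := minpoly ℚ N with hP_def
  have hP0 : P ≠ 0 := minpoly.ne_zero hNint
  have hPM : aeval (Matrix.of (M ψ)) P = 0 := by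
    have hNT : Nᵀ = Matrix.of (M ψ) := by rw [hN_def, hρ_apply, Matrix.transpose_transpose]
    rw [← hNT, aeval_transpose, minpoly.aeval, Matrix.transpose_zero]
  set Pc : ℂ[X] := P.map (algebraMap ℚ ℂ) with hPc_def
  have hPc0 : Pc ≠ 0 := (Polynomial.map_ne_zero_iff (algebraMap ℚ ℂ).injective).mpr hP0
  have hdegc : Pc.natDegree = P.natDegree := natDegree_map_eq_of_injective (algebraMap ℚ ℂ).injective P
  have hPT : aeval (complexBetti.map ψ.hom.hom.hom 1).hom Pc = 0 := by
    -- to complex matrices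
    have h1 : aeval (Φ (Matrix.of (M ψ))) P = 0 := by
      have h := congrArg (AlgHom.mapMatrix (Algebra.ofId ℚ ℂ)) hPM
      rw [← Polynomial.aeval_algHom_apply, map_zero] at h
      exact h
    have h2 : aeval (Φ (Matrix.of (M ψ))) Pc = 0 := by
      rw [hPc_def, Polynomial.aeval_map_algebraMap]
      exact h1
    rw [hMmap] at h2
    -- to endomorphisms of `H¹`
    have h3 : aeval (Matrix.toLinAlgEquiv b
        (LinearMap.toMatrixAlgEquiv b (complexBetti.map ψ.hom.hom.hom 1).hom)) Pc = 0 := by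
      rw [Polynomial.aeval_algEquiv, AlgHom.comp_apply, AlgEquiv.coe_toAlgHom, h2, map_zero]
    rwa [Matrix.toLinAlgEquiv_toMatrixAlgEquiv] at h3
  -- (7) the `2g` eigenvalues are roots of `Pc`
  have hroot : ∀ i, Pc.IsRoot (μ i) := fun i => by
    obtain ⟨v, hv⟩ := (hμe i).exists_hasEigenvector
    have h := Module.End.aeval_apply_of_hasEigenvector (p := Pc) hv
    rw [hPT, LinearMap.zero_apply] at h
    exact (smul_eq_zero.mp h.symm).resolve_right hv.2
  -- (8) degree count: `natDegree P = 2g`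
  have hsub : Finset.univ.image μ ⊆ Pc.roots.toFinset := by
    intro z hz
    obtain ⟨i, -, rfl⟩ := Finset.mem_image.mp hz
    exact Multiset.mem_toFinset.mpr ((Polynomial.mem_roots hPc0).mpr (hroot i))
  have hcard_roots : 2 * A.dim ≤ Pc.roots.toFinset.card := by
    calc 2 * A.dim = (Finset.univ.image μ).card := by
          rw [Finset.card_image_of_injective _ hμ, Finset.card_univ, Fintype.card_fin]
      _ ≤ _ := Finset.card_le_card hsub
  have h_le_deg : 2 * A.dim ≤ P.natDegree :=
    hcard_roots.trans ((Multiset.toFinset_card_le _).trans (hdegc ▸ Polynomial.card_roots' Pc))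
  have h_deg_le : P.natDegree ≤ 2 * A.dim := by
    have h := Polynomial.natDegree_le_of_dvd (Matrix.minpoly_dvd_charpoly N) (Matrix.charpoly_monic N).ne_zero
    rw [Matrix.charpoly_natDegree_eq_dim, hcard] at h
    exact h
  have hdeg : P.natDegree = 2 * A.dim := le_antisymm h_deg_le h_le_deg
  -- (9) `P` is square-free (it has `deg P` distinct complex roots)
  have hsplit : Pc.Splits := IsAlgClosed.splits Pc
  have hrootscard : Pc.roots.card = 2 * A.dim := by
    rw [Polynomial.splits_iff_card_roots.mp hsplit, hdegc, hdeg]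
  have hnodup : Pc.roots.Nodup := by
    rw [← Multiset.toFinset_card_eq_card_iff_nodup]
    refine le_antisymm (Multiset.toFinset_card_le _) ?_
    rw [hrootscard]
    exact hcard_roots
  have hsq : Squarefree P :=
    ((Polynomial.separable_map (algebraMap ℚ ℂ)).mp
      ((Polynomial.nodup_roots_iff_of_splits hPc0 hsplit).mp hnodup)).squarefree
  -- (10) conclusion: `S = ℚ[a]`, `a = 1 ⊗ ψ ∈ End⁰(A)`
  refine ⟨Algebra.adjoin ℚ {a}, isReduced_adjoin_singleton (by rw [hmin]; exact hsq),
    fun x hx y hy => mul_comm_of_mem_adjoin_singleton hx hy, ?_⟩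
  rw [finrank_adjoin_singleton_eq_natDegree haint, hmin, hdeg]

end Main

/-! ### Arrow form over the crux lines' CM typing `IsCM[A]` (registered sub-goal `cmSubalgebra_of_isCM`) -/

section Bridge

/-- `IsCM[A]` — CM type in the typing of the `HodgeAbelianVarieties` crux lines (verbatim from
`Cruxes/HodgeAbelianVarieties/Lines/cm_pivot.lean`): an endomorphism with `2 · dim A` distinct
eigenvalues on `H¹(A(ℂ); ℂ)`. Local notation only. -/
local notation3 (prettyPrint := false) "IsCM[" A "]" =>
  ∃ (ψ : A ⟶ A) (μ : Fin (2 * AbelianVariety.dim A) → ℂ), Function.Injective μ ∧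
    ∀ i, Module.End.HasEigenvalue (HodgeTheory.complexBetti.map ψ.hom.hom.hom 1).hom (μ i)

/-- **`IsCM[A]` ⟹ the CM hypothesis of the shared item `CMAbelianHodge` (stmt-HodgeConjecture-3052)**:
a complex abelian variety with an endomorphism having `2 · dim A` distinct eigenvalues on `H¹` has a
commutative reduced `ℚ`-subalgebra of `End⁰(A)` of dimension `2 · dim A` (`exists_cmSubalgebra_of_eigenvalues`,
arrow form). [cite: MumfordAV1970, §19 Thm. 3 Cor. and §22] -/
theorem cmSubalgebra_of_isCM :
    ∀ A : AbelianVariety ℂ, IsCM[A] →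
      ∃ S : Subalgebra ℚ A.endAlgebra, IsReduced ↥S ∧ (∀ x ∈ S, ∀ y ∈ S, x * y = y * x) ∧
        Module.finrank ℚ ↥S = 2 * A.dim :=
  fun A ⟨ψ, μ, hμ, hμe⟩ => exists_cmSubalgebra_of_eigenvalues A ψ μ hμ hμe

end Bridge

end Summit.HodgeConjecture.HodgeConjecture.Theorems.HodgeAbelianVarieties.CMPivot

end
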